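import Literature.MathematicalPhysics.QuantumFieldTheory.YangMillsOS
import Literature.MathematicalPhysics.QuantumFieldTheory.QCDTimeReflection
import Literature.MathematicalPhysics.QuantumFieldTheory.WilsonSiteRPForm
import HarnessLib

/-!
# Time reflection of Yang–Mills species and of species schemes

G-blind bookkeeping for the Osterwalder–Schrader argument on the lattice side of `IsYangMillsFor`
(`YangMillsOS`): lattice reflection positivity pairs the smeared field of a species
`s : YMSpecies G = LocalGaugeObservable 4 G` with that of the TIME-REFLECTED species `s.timeReflect`
(the observable read on the reflected gauge field), so witness renormalisations `(c_s, m_s)` enter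
through their behaviour under `s ↦ s.timeReflect`. Nothing about mass gaps is asserted. Content:

* complements on the SITE time reflection `θ₀ : (x⁰, x⃗) ↦ (−x⁰, x⃗)` of `ℤ⁴` and the induced
  reflection `Θ₀ = cfgReflect` of gauge fields (`QCDTimeReflection`; temporal links reversed and
  inverted): additivity, `reflectEdge_reflectEdge`, `cfgReflect_cfgReflect`, the intertwining
  `cfgReflect_configShift` (`Θ₀ ∘ τ_v = τ_{θ₀v} ∘ Θ₀`), and `torusLift_negReflect`
  (`torusLift S (Θ'U) = Θ₀ (torusLift S U)`, `Θ' = GaugeConfig.negReflect` the torus site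
  reflection of `ConstructiveQFTWave0SiteRPProofs`);
* (T1) `Θ'`-invariance of Wilson's measure `wilsonMeasure ρ β` on EVERY torus `(ℤ/Lℤ)^d`, odd
  sides included (`wilsonAction_negReflect_eq`, `wilsonMeasure_map_negReflect_eq`,
  `integral_comp_negReflect_eq`; the even case is `WilsonSiteRP.wilsonMeasure_map_negReflect`);
* (D1) `LocalGaugeObservable.timeReflect s` = `U ↦ s.F (Θ₀U)` (reflected support, cylinder,
  gauge invariant via `g ↦ g ∘ θ₀`, bounded, measurable), an involution;
* (D2) `SpeciesScheme.reflectSpecies` (same `a, β, L`; `c s := c (Θs)`, `m s := m (Θs)`),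
  `SpeciesScheme.IsReflectionSymmetric`, `reflectSpecies_eq_self_of_isReflectionSymmetric`;
* (T2) `smearedLatticeField O Λ a c m (θf) V = smearedLatticeField (O ∘ Θ₀) Λ a c m f (Θ₀V)`
  (`Λ = box 4 R`, `θf = thetaTest 4 f`) and `latticeSchwinger_thetaTest`:
  `latticeSchwinger ρ sch F k n σ (θf) = latticeSchwinger ρ sch.reflectSpecies F k n (Θσ) f`.

Convention: time is coordinate `0` and the reflection is the SITE reflection `t ↦ −t` at all
levels (continuum `timeReflection 4` / `thetaTest 4`, `ℤ⁴` `siteReflect` / `cfgReflect`, torus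
`Site.negReflect` / `GaugeConfig.negReflect`) — the one compatible with `x ↦ a • siteToE x`
(`timeReflection_smul_siteToE`); NOT the link reflection `t ↦ 1 − t` (`GaugeConfig.timeReflect`).
References: K. Osterwalder, E. Seiler, Ann. Phys. 110 (1978) 440, §2; E. Seiler, LNP 159 (1982)
Ch. 2. All statements here are proved.
-/

open scoped SchwartzMap
open MeasureTheory Filter Finset
open Literature.Probability Literature.Probability.LatticeModels
open Literature.MathematicalPhysics.QuantumLattice

noncomputable section

namespace Literature.MathematicalPhysics.QuantumFieldTheory

/-! ### Complements on the site reflection of `ℤ⁴` and of its gauge fields -/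

section Zd

variable {G : Type*} [Group G]

/-- Pointwise formula for the site reflection: `(θ₀x)_k = -x_k` for `k = 0`, `x_k` otherwise. [folklore] -/
theorem siteReflect_apply_ite (x : LatticeModels.Site 4) (k : Fin 4) :
    siteReflect x k = if k = 0 then -x k else x k := by
  by_cases hk : k = 0
  · subst hk; simp
  · simp [siteReflect_apply_of_ne _ hk, hk]

/-- The site reflection commutes with negation. [folklore] -/
theorem siteReflect_neg (x : LatticeModels.Site 4) : siteReflect (-x) = -siteReflect x := by
  funext k
  simp only [siteReflect_apply_ite, Pi.neg_apply]
  split_ifs <;> ring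

/-- The site reflection is compatible with subtraction (it is additive). [folklore] -/
theorem siteReflect_sub (x y : LatticeModels.Site 4) :
    siteReflect (x - y) = siteReflect x - siteReflect y := by
  funext k
  simp only [siteReflect_apply_ite, Pi.sub_apply]
  split_ifs <;> ring

/-- The edge reflection `reflectEdge` is an involution. [folklore] -/
@[simp] theorem reflectEdge_reflectEdge (e : ZdEdge 4) : reflectEdge (reflectEdge e) = e := by
  obtain ⟨x, i⟩ := e
  by_cases hi : i = 0
  · subst hi
    have h := siteReflect_add_single_zero (siteReflect x - Pi.single 0 1)
    rw [sub_add_cancel, siteReflect_siteReflect] at h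
    simp only [reflectEdge, ↓reduceIte, ← h]
  · simp only [reflectEdge, if_neg hi, siteReflect_siteReflect]

/-- The edge reflection preserves the direction of an edge. [folklore] -/
theorem reflectEdge_snd (e : ZdEdge 4) : (reflectEdge e).2 = e.2 := by
  unfold reflectEdge
  split_ifs with h <;> simp [h]

/-- **The gauge-field reflection `Θ₀` is an involution**, `Θ₀ (Θ₀ U) = U`. [folklore] -/
@[simp] theorem cfgReflect_cfgReflect (U : LGConfig 4 G) : cfgReflect (cfgReflect U) = U := by
  funext e
  by_cases he : e.2 = 0
  · simp only [cfgReflect, he, ↓reduceIte, reflectEdge_snd, inv_inv, reflectEdge_reflectEdge]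
  · simp only [cfgReflect, he, ↓reduceIte, reflectEdge_snd, reflectEdge_reflectEdge]

/-- **`Θ₀` intertwines the lattice translations**: `Θ₀ (τ U) = τ' (Θ₀ U)` where `τ = configShift v`
and `τ' = configShift (θ₀ v)` (`(configShift v U)(x, i) = U(x - v, i)`). [folklore] -/
theorem cfgReflect_configShift [MeasurableSpace G] (v : LatticeModels.Site 4) (U : LGConfig 4 G) :
    cfgReflect (configShift v U) = configShift (siteReflect v) (cfgReflect U) := by
  funext ⟨y, i⟩
  by_cases hi : i = 0
  · subst hi
    simp only [cfgReflect, reflectEdge, ↓reduceIte, QuantumLattice.configShift_apply,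
      siteReflect_sub, siteReflect_siteReflect]
    rw [sub_right_comm]
  · simp only [cfgReflect, reflectEdge, if_neg hi, QuantumLattice.configShift_apply,
      siteReflect_sub, siteReflect_siteReflect]

/-- The reflected embedded lattice point: `θ (a • x) = a • (θ₀ x)` in `ℝ⁴`, `θ` the continuum time
reflection `timeReflection 4`. [folklore] -/
theorem timeReflection_smul_siteToE (a : ℝ) (x : LatticeModels.Site 4) :
    timeReflection 4 (a • siteToE x) = a • siteToE (siteReflect x) := by
  ext i
  by_cases hi : i = 0
  · subst hi
    simp [siteReflect_apply_ite]
  · simp [hi, siteReflect_apply_of_ne _ hi]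

/-- **Torus compatibility**: the periodic lift of the torus site reflection `Θ'` of a
configuration on `(ℤ/Sℤ)⁴` is the `ℤ⁴` reflection `Θ₀` of its periodic lift,
`torusLift S (Θ'U) = Θ₀ (torusLift S U)` (reduction mod `S` commutes with `t ↦ -t`). [folklore] -/
theorem torusLift_negReflect {S : ℕ} (U : GaugeConfig 4 S G) :
    torusLift S U.negReflect = cfgReflect (torusLift S U) := by
  have hproj : ∀ y : LatticeModels.Site 4,
      Torus.proj S (siteReflect y) = Site.negReflect (Torus.proj S y) := fun y => by
    funext k
    by_cases hk : k = 0
    · subst hk; simp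
    · simp [WilsonSiteRP.negReflect_apply_of_ne _ hk, siteReflect_apply_of_ne _ hk]
  have hproj' : ∀ y : LatticeModels.Site 4, Torus.proj S (siteReflect y - Pi.single 0 1) =
      Site.negReflect (Site.shift (Torus.proj S y) 0) := fun y => by
    funext k
    by_cases hk : k = 0
    · subst hk; simp only [Torus.proj_apply, Pi.sub_apply, siteReflect_apply_zero, Pi.single_eq_same,
        Int.cast_sub, Int.cast_neg, Int.cast_one, WilsonSiteRP.negReflect_apply_zero,
        WilsonRP.shift_apply_self]; ring
    · simp [WilsonSiteRP.negReflect_apply_of_ne _ hk, WilsonRP.shift_apply_of_ne _ hk,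
        siteReflect_apply_of_ne _ hk, hk]
  funext ⟨y, i⟩
  by_cases hi : i = 0
  · subst hi
    simp only [torusLift, Function.comp_apply, torusEdge, GaugeConfig.negReflect, cfgReflect,
      reflectEdge, ↓reduceIte, hproj']
  · simp only [torusLift, Function.comp_apply, torusEdge, GaugeConfig.negReflect, cfgReflect,
      reflectEdge, if_neg hi, hproj]

end Zd

/-! ### (T1) Invariance of Wilson's torus measure under the site time reflection, every side -/

section TorusInvariance

variable {d L N : ℕ} [NeZero d] [NeZero L]
variable {G : Type*} [Group G] [TopologicalSpace G] [IsTopologicalGroup G] [CompactSpace G]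
  [MeasurableSpace G] [BorelSpace G]
variable (ρ : G →* Matrix (Fin N) (Fin N) ℂ)

omit [MeasurableSpace G] [BorelSpace G] in
/-- `∑ₚ Re tr ρ((Θ'U)_p) = ∑ₚ Re tr ρ(U_p)`: `Θ'` permutes the plaquettes (`sitePlaqReflectEquiv`) up
to inversion/conjugation of the holonomy, invisible to `Re tr ρ`. [cite: OsterwalderSeiler1978, §2] -/
theorem sum_plaqRe_negReflect (hρ : Continuous ρ) (U : GaugeConfig d L G) :
    ∑ p, WilsonRP.plaqRe ρ U.negReflect p = ∑ p, WilsonRP.plaqRe ρ U p := by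
  simp_rw [WilsonSiteRP.plaqRe_negReflect ρ hρ U]
  exact Equiv.sum_comp WilsonSiteRP.sitePlaqReflectEquiv (WilsonRP.plaqRe ρ U)

omit [MeasurableSpace G] [BorelSpace G] in
/-- **The Wilson action is `Θ'`-invariant on every torus** `(ℤ/Lℤ)^d`: `S(Θ'U) = S(U)`
(continuous `ρ`; no parity assumption on `L`). [cite: OsterwalderSeiler1978, §2] -/
theorem wilsonAction_negReflect_eq (hρ : Continuous ρ) (U : GaugeConfig d L G) :
    wilsonAction ρ U.negReflect = wilsonAction ρ U := by
  rw [WilsonRP.wilsonAction_eq, WilsonRP.wilsonAction_eq, sum_plaqRe_negReflect ρ hρ U]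

/-- **Wilson's torus measure is `Θ'`-invariant on every torus**: `μ_{Λ,β} ∘ Θ'⁻¹ = μ_{Λ,β}`
(product Haar measure is invariant under the link permutation and inversion of temporal links,
`WilsonSiteRP.measurePreserving_negReflect`; the Boltzmann weight by `wilsonAction_negReflect_eq`).
[cite: OsterwalderSeiler1978, §2] -/
theorem wilsonMeasure_map_negReflect_eq (hρ : Continuous ρ) (β : ℝ) :
    (wilsonMeasure (d := d) (L := L) ρ β).map GaugeConfig.negReflect = wilsonMeasure ρ β := by
  have hbase : (Measure.pi fun _ : Edge d L => haarProbability G).map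
      (WilsonSiteRP.negReflectEquiv (d := d) (L := L) (G := G)) =
        Measure.pi fun _ => haarProbability G :=
    (WilsonSiteRP.measurePreserving_negReflect (d := d) (L := L) (G := G)).map_eq
  have hw := WilsonGauge.withDensity_map_equiv_of_invariant
    (Measure.pi fun _ : Edge d L => haarProbability G) WilsonSiteRP.negReflectEquiv
    (fun U => ENNReal.ofReal (Real.exp (-β * wilsonAction ρ U))) hbase
    (fun U => by
      show ENNReal.ofReal (Real.exp (-β * wilsonAction ρ (GaugeConfig.negReflect U))) = _
      rw [wilsonAction_negReflect_eq ρ hρ])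
  unfold wilsonMeasure
  rw [Measure.map_smul]
  exact congrArg _ hw

/-- `Θ'` preserves Wilson's torus measure (every side `L`). [cite: OsterwalderSeiler1978, §2] -/
theorem measurePreserving_negReflect_wilsonMeasure (hρ : Continuous ρ) (β : ℝ) :
    MeasurePreserving GaugeConfig.negReflect (wilsonMeasure (d := d) (L := L) ρ β)
      (wilsonMeasure ρ β) :=
  ⟨WilsonSiteRP.measurable_negReflect, wilsonMeasure_map_negReflect_eq ρ hρ β⟩

/-- Change of variables under the reflection, every side `L`:
`∫ f(Θ'U) dμ_{Λ,β}(U) = ∫ f dμ_{Λ,β}`. [cite: OsterwalderSeiler1978, §2] -/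
theorem integral_comp_negReflect_eq (hρ : Continuous ρ) (β : ℝ)
    {E : Type*} [NormedAddCommGroup E] [NormedSpace ℝ E] (f : GaugeConfig d L G → E) :
    ∫ U, f U.negReflect ∂(wilsonMeasure ρ β) = ∫ U, f U ∂(wilsonMeasure ρ β) :=
  MeasurePreserving.integral_comp' (f := WilsonSiteRP.negReflectEquiv)
    (measurePreserving_negReflect_wilsonMeasure ρ hρ β) f

end TorusInvariance

/-! ### (D1) The time-reflected species -/

section Species

variable {G : Type*} [Group G] [MeasurableSpace G] [MeasurableInv G]

/-- **The time-reflected local gauge observable** `Θs`: `(Θs)(U) = s.F (Θ₀ U)`, the observable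
read on the site-time-reflected gauge field (`cfgReflect`: spatial link `(x, i) ↦ U(θ₀x, i)`,
temporal link `(x, 0) ↦ U(θ₀x − e₀, 0)⁻¹`); again a local gauge-invariant observable (support
`reflectEdge '' supp`; gauge invariant as `Θ₀(U^g) = (Θ₀U)^{g ∘ θ₀}`; same bound; measurable since
inversion is). A dot-notation extension of `QuantumLattice.LocalGaugeObservable`. [cite: OsterwalderSeiler1978, §2] -/
def _root_.Literature.MathematicalPhysics.QuantumLattice.LocalGaugeObservable.timeReflect
    (s : LocalGaugeObservable 4 G) : LocalGaugeObservable 4 G where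
  F U := s.F (cfgReflect U)
  supp := s.supp.image reflectEdge
  isCylinder := by
    intro U V hUV
    refine s.isCylinder fun e he => ?_
    have h := hUV (reflectEdge e) (Finset.mem_coe.2 (Finset.mem_image_of_mem _ he))
    change cfgReflect U e = cfgReflect V e
    simp only [cfgReflect, h]
  gaugeInvariant g U := by
    change s.F (cfgReflect (gaugeTransformZd g U)) = s.F (cfgReflect U)
    rw [cfgReflect_gaugeTransformZd, s.gaugeInvariant]
  bounded := s.bounded.imp fun _ hC U => hC (cfgReflect U)
  measurable := s.measurable.comp measurable_cfgReflect

/-- The underlying function of the reflected species. [folklore] -/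
@[simp] theorem _root_.Literature.MathematicalPhysics.QuantumLattice.LocalGaugeObservable.timeReflect_F
    (s : LocalGaugeObservable 4 G) : s.timeReflect.F = fun U => s.F (cfgReflect U) := rfl

/-- The support of the reflected species is the reflected support. [folklore] -/
@[simp] theorem _root_.Literature.MathematicalPhysics.QuantumLattice.LocalGaugeObservable.timeReflect_supp
    (s : LocalGaugeObservable 4 G) : s.timeReflect.supp = s.supp.image reflectEdge := rfl

/-- **Time reflection of species is an involution**: `ΘΘs = s`. [folklore] -/
@[simp] theorem _root_.Literature.MathematicalPhysics.QuantumLattice.LocalGaugeObservable.timeReflect_timeReflect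
    (s : LocalGaugeObservable 4 G) : s.timeReflect.timeReflect = s := by
  obtain ⟨F, supp, h1, h2, h3, h4⟩ := s
  have himg : (supp.image reflectEdge).image reflectEdge = supp := by
    rw [Finset.image_image, show reflectEdge ∘ reflectEdge = id from funext reflectEdge_reflectEdge,
      Finset.image_id]
  simp only [LocalGaugeObservable.timeReflect, cfgReflect_cfgReflect, himg]

end Species

/-! ### (D2) The species-reflected scheme and reflection-symmetric schemes -/

namespace SpeciesScheme

variable {G : Type} [Group G] [MeasurableSpace G] [MeasurableInv G]

/-- **The species-reflected scheme**: same spacings `a`, couplings `β`, half-sides `L`; the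
renormalisations of the species `s` are those `sch` assigns to the reflected species,
`c s k := sch.c (Θs) k`, `m s k := sch.m (Θs) k`. [folklore] -/
def reflectSpecies (sch : SpeciesScheme (YMSpecies G)) : SpeciesScheme (YMSpecies G) where
  a := sch.a
  a_pos := sch.a_pos
  tendsto_a := sch.tendsto_a
  β := sch.β
  L := sch.L
  tendsto_L := sch.tendsto_L
  c s k := sch.c s.timeReflect k
  m s k := sch.m s.timeReflect k

/-- Same spacings. [folklore] -/
@[simp] theorem reflectSpecies_a (sch : SpeciesScheme (YMSpecies G)) : sch.reflectSpecies.a = sch.a := rfl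

/-- Same couplings. [folklore] -/
@[simp] theorem reflectSpecies_β (sch : SpeciesScheme (YMSpecies G)) : sch.reflectSpecies.β = sch.β := rfl

/-- Same half-sides. [folklore] -/
@[simp] theorem reflectSpecies_L (sch : SpeciesScheme (YMSpecies G)) : sch.reflectSpecies.L = sch.L := rfl

/-- Same torus sides. [folklore] -/
@[simp] theorem reflectSpecies_side (sch : SpeciesScheme (YMSpecies G)) (k : ℕ) :
    sch.reflectSpecies.side k = sch.side k := rfl

/-- Renormalisations of the reflected scheme. [folklore] -/
@[simp] theorem reflectSpecies_c (sch : SpeciesScheme (YMSpecies G)) (s : YMSpecies G) (k : ℕ) :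
    sch.reflectSpecies.c s k = sch.c s.timeReflect k := rfl

/-- Counterterms of the reflected scheme. [folklore] -/
@[simp] theorem reflectSpecies_m (sch : SpeciesScheme (YMSpecies G)) (s : YMSpecies G) (k : ℕ) :
    sch.reflectSpecies.m s k = sch.m s.timeReflect k := rfl

/-- Reflecting the species twice gives back the scheme. [folklore] -/
@[simp] theorem reflectSpecies_reflectSpecies (sch : SpeciesScheme (YMSpecies G)) :
    sch.reflectSpecies.reflectSpecies = sch := by
  obtain ⟨a, ha, hta, β, L, htL, c, m⟩ := sch
  simp [reflectSpecies]

/-- **Reflection-symmetric witness renormalisations**: `c_{Θs} = c_s` and `m_{Θs} = m_s` for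
every species `s` and every step `k`. [folklore] -/
def IsReflectionSymmetric (sch : SpeciesScheme (YMSpecies G)) : Prop :=
  ∀ (s : YMSpecies G) (k : ℕ), sch.c s.timeReflect k = sch.c s k ∧ sch.m s.timeReflect k = sch.m s k

/-- A reflection-symmetric scheme is its own species reflection. [folklore] -/
theorem reflectSpecies_eq_self_of_isReflectionSymmetric {sch : SpeciesScheme (YMSpecies G)}
    (h : sch.IsReflectionSymmetric) : sch.reflectSpecies = sch := by
  obtain ⟨a, ha, hta, β, L, htL, c, m⟩ := sch
  simp only [reflectSpecies, SpeciesScheme.mk.injEq, true_and]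
  exact ⟨funext fun s => funext fun k => (h s k).1, funext fun s => funext fun k => (h s k).2⟩

/-- The degenerate scheme `SpeciesScheme.zero` is reflection symmetric (non-vacuity). [folklore] -/
theorem isReflectionSymmetric_zero : (SpeciesScheme.zero (YMSpecies G)).IsReflectionSymmetric :=
  fun _ _ => ⟨rfl, rfl⟩

end SpeciesScheme

/-! ### (T2) The reflection identity of smeared fields and lattice Schwinger functions -/

section Schwinger

variable {G : Type} [Group G] [MeasurableSpace G]

/-- **Reflection identity of the smeared lattice field** (pointwise in the configuration):
`Φ[O, c, m](θf)(V) = Φ[O ∘ Θ₀, c, m](f)(Θ₀V)` over the `θ₀`-symmetric box `{−R,…,R}⁴`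
(`(θf)(x) = f(θx)`; reindex `x ↦ θ₀x` and use `τ_{θ₀x} = Θ₀ ∘ τ_x ∘ Θ₀`). [folklore] -/
theorem smearedLatticeField_thetaTest (O : LGConfig 4 G → ℝ) (R : ℕ) (a c m : ℝ)
    (f : 𝓢(EuclideanSpace ℝ (Fin 4), ℝ)) (V : LGConfig 4 G) :
    smearedLatticeField O (box 4 R) a c m (thetaTest 4 f) V =
      smearedLatticeField (fun U => O (cfgReflect U)) (box 4 R) a c m f (cfgReflect V) := by
  unfold smearedLatticeField
  congr 1
  refine Finset.sum_nbij' siteReflect siteReflect (fun x hx => siteReflect_mem_box hx)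
    (fun x hx => siteReflect_mem_box hx) (fun x _ => siteReflect_siteReflect x)
    (fun x _ => siteReflect_siteReflect x) fun x _ => ?_
  simp only [thetaTest_apply, timeReflection_smul_siteToE, cfgReflect_configShift, siteReflect_neg,
    siteReflect_siteReflect, cfgReflect_cfgReflect]

variable [TopologicalSpace G] [IsTopologicalGroup G] [CompactSpace G] [BorelSpace G]
variable {N : ℕ} (ρ : G →* Matrix (Fin N) (Fin N) ℂ)

/-- **Reflection identity under Wilson's torus measure**: for products of smeared fields read on
the periodic lift, `∫ ∏ᵢ Φ[Oᵢ](θfᵢ)(Ũ) dμ = ∫ ∏ᵢ Φ[Oᵢ ∘ Θ₀](fᵢ)(Ũ) dμ` (pointwise identity,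
`Θ₀ Ũ = (Θ'U)~` and `Θ'`-invariance of `μ = wilsonMeasure ρ β`, any side `S`). [cite: OsterwalderSeiler1978, §2] -/
theorem integral_prod_smearedLatticeField_thetaTest (hρ : Continuous ρ) (β : ℝ) (S : ℕ) [NeZero S]
    {n : ℕ} (O : Fin n → LGConfig 4 G → ℝ) (R : ℕ) (a : ℝ) (c m : Fin n → ℝ)
    (f : Fin n → 𝓢(EuclideanSpace ℝ (Fin 4), ℝ)) :
    ∫ U, ∏ i, smearedLatticeField (O i) (box 4 R) a (c i) (m i) (thetaTest 4 (f i))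
        (torusLift S U) ∂(wilsonMeasure (d := 4) (L := S) ρ β) =
      ∫ U, ∏ i, smearedLatticeField (fun V => O i (cfgReflect V)) (box 4 R) a (c i) (m i) (f i)
        (torusLift S U) ∂(wilsonMeasure (d := 4) (L := S) ρ β) := by
  simp_rw [smearedLatticeField_thetaTest, ← torusLift_negReflect]
  exact integral_comp_negReflect_eq ρ hρ β fun U => ∏ i,
    smearedLatticeField (fun V => O i (cfgReflect V)) (box 4 R) a (c i) (m i) (f i) (torusLift S U)

/-- **Reflection identity of the joint lattice Schwinger functions**: reflecting all test
functions equals reflecting all species in the species-reflected scheme,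
`S^{sch}_{k,n}(σ; θf₁,…,θfₙ) = S^{sch.reflectSpecies}_{k,n}(Θσ₁,…,Θσₙ; f₁,…,fₙ)`. [cite: OsterwalderSeiler1978, §2] -/
theorem latticeSchwinger_thetaTest (hρ : Continuous ρ) (sch : SpeciesScheme (YMSpecies G))
    (k n : ℕ) (σ : Fin n → YMSpecies G) (f : Fin n → 𝓢(EuclideanSpace ℝ (Fin 4), ℝ)) :
    latticeSchwinger ρ sch (fun s => s.F) k n σ (fun i => thetaTest 4 (f i)) =
      latticeSchwinger ρ sch.reflectSpecies (fun s => s.F) k n (fun i => (σ i).timeReflect) f := by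
  unfold latticeSchwinger
  dsimp only [SpeciesScheme.reflectSpecies_a, SpeciesScheme.reflectSpecies_β,
    SpeciesScheme.reflectSpecies_side, SpeciesScheme.reflectSpecies_L,
    SpeciesScheme.reflectSpecies_c, SpeciesScheme.reflectSpecies_m,
    LocalGaugeObservable.timeReflect_F]
  simp only [LocalGaugeObservable.timeReflect_timeReflect]
  exact integral_prod_smearedLatticeField_thetaTest ρ hρ (sch.β k) (sch.side k)
    (fun i => (σ i).F) (sch.L k) (sch.a k) (fun i => sch.c (σ i) k) (fun i => sch.m (σ i) k) f

/-- The same identity read from the other side: reflected species against reflected test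
functions are the original species in the species-reflected scheme. [folklore] -/
theorem latticeSchwinger_timeReflect_thetaTest (hρ : Continuous ρ)
    (sch : SpeciesScheme (YMSpecies G)) (k n : ℕ) (σ : Fin n → YMSpecies G)
    (f : Fin n → 𝓢(EuclideanSpace ℝ (Fin 4), ℝ)) :
    latticeSchwinger ρ sch (fun s => s.F) k n (fun i => (σ i).timeReflect)
        (fun i => thetaTest 4 (f i)) =
      latticeSchwinger ρ sch.reflectSpecies (fun s => s.F) k n σ f := by
  rw [latticeSchwinger_thetaTest ρ hρ]
  simp only [LocalGaugeObservable.timeReflect_timeReflect]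

/-- **For reflection-symmetric renormalisations** the scheme is unchanged:
`S^{sch}_{k,n}(σ; θf) = S^{sch}_{k,n}(Θσ; f)`. [folklore] -/
theorem SpeciesScheme.IsReflectionSymmetric.latticeSchwinger_thetaTest (hρ : Continuous ρ)
    {sch : SpeciesScheme (YMSpecies G)} (h : sch.IsReflectionSymmetric) (k n : ℕ)
    (σ : Fin n → YMSpecies G) (f : Fin n → 𝓢(EuclideanSpace ℝ (Fin 4), ℝ)) :
    latticeSchwinger ρ sch (fun s => s.F) k n σ (fun i => thetaTest 4 (f i)) =
      latticeSchwinger ρ sch (fun s => s.F) k n (fun i => (σ i).timeReflect) f := by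
  rw [QuantumFieldTheory.latticeSchwinger_thetaTest ρ hρ,
    SpeciesScheme.reflectSpecies_eq_self_of_isReflectionSymmetric h]

end Schwinger

end Literature.MathematicalPhysics.QuantumFieldTheory

end
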